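import Literature.MathematicalPhysics.QuantumFieldTheory.QCDOS

/-!
# `SeaFactorisationBridge` (crux stmt-QuantumFields-13880) — negative-side support: the regularisation
# prefix certified by `CoerciveSea` does not make its `reg` usable in the conclusion

Standing-disprover extraction (cdisprove cycle 1).  `CoerciveSea` hands the prover a regularisation
`reg` with `HasMassScaling` and asymptotic scaling of `reg.scheme 0 0 0`; the bridge's conclusion needs
`IsQCDAlong (reg'.scheme m z shift) T`, whose physical-branch clause `m_f(k) > −1` is NOT implied by that
prefix.  Witness: the canonical a.f. regularisation with `m_crit(k) := −5 − k·a_k/Z_m(k)`.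

* `prefix_reg_offBranch` — the strengthening of the conclusion to "∀ reg with the prefix" is FALSE; the
  `∃ reg` is load-bearing, and branch information on `CoerciveSea`'s `reg` must be extracted from its
  clauses (ii)–(iii) before reuse (no such lemma exists).
-/

noncomputable section

namespace Summit.QuantumFields.QCD.Theorems.SeaFactorisationBridge.Negative

open Filter Topology Literature.MathematicalPhysics.QuantumFieldTheory

/-- **Off-branch regularisation with the full `CoerciveSea` prefix**: `HasMassScaling`, asymptotic
scaling, and `¬ IsQCDAlong (reg.scheme m z shift) T` for every `m, z, shift, T` (the bare masses are
`−5 + (a_k/Z_m(k))(m_f − k) ≤ −5` as soon as `k ≥ m_f`). [folklore] -/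
theorem prefix_reg_offBranch (Nf : ℕ) [NeZero Nf] :
    ∃ reg : QCDRegularisation Nf, reg.HasMassScaling ∧ (reg.scheme 0 0 0).HasAsymptoticScaling ∧
      ∀ (m : Fin Nf → ℝ) (z shift : QCDField Nf → ℕ → ℝ) (T : OSData (QCDField Nf) 4),
        ¬ IsQCDAlong (reg.scheme m z shift) T := by
  let R := QCDRegularisation.canonicalAF Nf
  refine ⟨{ R with mcrit := fun k => -5 - k * (R.a k / R.Zm k) }, ?_, ?_, ?_⟩
  · exact QCDRegularisation.canonicalAF_hasMassScaling
  · exact ⟨1, one_pos, tendsto_const_nhds.congr' (Eventually.of_forall fun k => (sub_self _).symm)⟩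
  · intro m z shift T hQ
    obtain ⟨-, hbranch, -⟩ := hQ
    have h0 := hbranch 0
    have hk := tendsto_natCast_atTop_atTop (R := ℝ) |>.eventually_ge_atTop (m 0)
    obtain ⟨k, hk1, hk2⟩ := (h0.and hk).exists
    have hpos : 0 < R.a k / R.Zm k := div_pos (R.a_pos k) (R.Zm_pos k)
    have hmq : (({ R with mcrit := fun k => -5 - k * (R.a k / R.Zm k) } : QCDRegularisation Nf).scheme
        m z shift).mq 0 k = -5 + (R.a k / R.Zm k) * (m 0 - k) := by
      simp only [QCDRegularisation.scheme_mq]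
      show -5 - k * (R.a k / R.Zm k) + R.a k * m 0 / R.Zm k = _
      ring
    rw [hmq] at hk1
    nlinarith [mul_nonpos_of_nonneg_of_nonpos hpos.le (sub_nonpos.2 hk2)]

end Summit.QuantumFields.QCD.Theorems.SeaFactorisationBridge.Negative

end
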